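import Literature.Algebra.Polynomial.LaguerreRootBound
import Summits.Ventures.HSemireg.WedgeHankelRecurrenceGaussDistributionApproximation

/-!
# Venture HSemireg — **LAGUERRE–SAMUELSON BOUNDS FOR THE GAUSS NODES FROM THE RECURRENCE COEFFICIENTS**: if `q_{m+2} = ∏_k (X − z_k)` for the recurrence `q_{k+2} = (X − a_{k+1}) q_{k+1} − b_{k+1} q_k`
# (e.g. `b > 0`, N279), then with `A = Σ_{i≤m+1} a_i` (`= Σ_k z_k = tr J`) and `S = Σ_{i≤m+1} a_i² + 2 Σ_{i≤m} b_{i+1}` (`= Σ_k z_k² = tr J²`, N298) EVERY node satisfies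
# `((m+2) z_k − A)² ≤ (m + 1) · ((m+2) S − A²)`, i.e. `|z_k − mean| ≤ √(m+1) · (standard deviation of the nodes)` — explicit a-priori eigenvalue bounds for the Jacobi matrix

HONEST FRAMING. Part of the Lean index of the computation cell `pub-hsemireg` (seat p10 gen 43, Sunday typer «UNIFORM-IN-n»).  Real polynomials and one algebraic inequality; no variety, no cohomology
theory, no sheaf, no Ext group and no semiregularity map is constructed here; nothing here says that HC / HC_CM / HC_AV holds; no Literature fact (unproved `Prop`) is declared or used.  Custodian
versions as in `WedgeHankelSiegelIdeal` (1/3).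
SOURCES (cited).  E. N. Laguerre, *Sur une méthode pour obtenir par approximation les racines d'une équation algébrique qui a toutes ses racines réelles*, Nouv. Ann. Math. (2) 19 (1880); P. A. Samuelson,
*How deviant can you be?*, J. Amer. Statist. Assoc. 63 (1968) 1522–1525; M. Aigner, G. M. Ziegler, *Proofs from THE BOOK*, Ch. 17 Thm 1 (the tree's `Literature/Algebra/Polynomial/LaguerreRootBound`);
T. S. Chihara, *An Introduction to Orthogonal Polynomials* (1978), Ch. I (4.13)–(4.14); G. H. Golub, J. H. Welsch (1969) (eigenvalue bounds for `J`).
PROOF TYPED HERE.  Literature `laguerre_sq_le` for the monic real-rooted `q_{m+2}` (roots `= {z_k}`, N298 `roots_prod_X_sub_C_fin`), with `[X^{m+1}] q_{m+2} = −A` (N298 `coeff_recurrence_sub_one`) and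
`c_1² − 2 c_2 = S` (N298 `coeff_recurrence_newton_two`), cleared of denominators.
DEDUP DISCLOSURE (`rg -n 'laguerre|samuelson' Summits/Ventures/HSemireg`, 2026-09-03): nothing for the recurrence ∕ Jacobi matrix; the Literature lemma is cited by import.  The 2 names below: 0 hits
tree-wide.

WHAT IS IN THE TREE.  Literature `Algebra.Polynomial.LaguerreRootBound.laguerre_sq_le`; N279 `recurrence_monic_natDegree`, `recurrence_zeros`; N298 `roots_prod_X_sub_C_fin`, `coeff_recurrence_sub_one`,
`coeff_recurrence_newton_two`.
THIS FILE (namespace `Summit.Ventures.HSemireg.Wedge.HankelOuter` continued; CHAINED on N311 (import), N279, N298; PLAIN on Literature `LaguerreRootBound`; 0 definitions):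
* §1077 **`recurrence_zeros_laguerre_samuelson`** (`((m+2) z_k − A)² ≤ (m+1)((m+2) S − A²)` for every zero `z_k` of `q_{m+2} = ∏ (X − z_k)`), **`recurrence_zeros_laguerre_samuelson_of_pos`** (the same for a
  positive recurrence, with the zeros supplied by N279).
CAVEATS.  No sharpness statement.  Nothing Ext-side.  New names only.
-/

open Module Polynomial
open scoped Matrix Polynomial

namespace Summit.Ventures.HSemireg.Wedge.HankelOuter

/-! ## §1077. Laguerre–Samuelson bounds for the Gauss nodes -/

/-- **LAGUERRE–SAMUELSON FOR THE RECURRENCE.**  If `q_{m+2} = ∏_k (X − z_k)` (`q_0 = 1`, `q_1 = X − a_0`, `q_{k+2} = (X − a_{k+1}) q_{k+1} − b_{k+1} q_k`), then with `A = Σ_{i≤m+1} a_i` and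
`S = Σ_{i≤m+1} a_i² + 2 Σ_{i≤m} b_{i+1}` every zero satisfies `((m+2) z_k − A)² ≤ (m+1) ((m+2) S − A²)`. [Laguerre 1880; Samuelson 1968; Aigner–Ziegler Ch. 17 Thm 1; this file, §1077] -/
theorem recurrence_zeros_laguerre_samuelson {q : ℕ → ℝ[X]} {a b : ℕ → ℝ} (hq0 : q 0 = 1) (hq1 : q 1 = Polynomial.X - C (a 0))
    (hrec : ∀ n, q (n + 2) = (Polynomial.X - C (a (n + 1))) * q (n + 1) - C (b (n + 1)) * q n) {m : ℕ} {z : Fin (m + 2) → ℝ}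
    (hzq : q (m + 2) = ∏ k, (Polynomial.X - C (z k))) (k : Fin (m + 2)) :
    (((m : ℝ) + 2) * z k - ∑ i ∈ Finset.range (m + 2), a i) ^ 2 ≤
      ((m : ℝ) + 1) * (((m : ℝ) + 2) * (∑ i ∈ Finset.range (m + 2), a i ^ 2 + 2 * ∑ i ∈ Finset.range (m + 1), b (i + 1)) - (∑ i ∈ Finset.range (m + 2), a i) ^ 2) := by
  have hmd := recurrence_monic_natDegree hq0 hq1 hrec (m + 2)
  have hroots : (q (m + 2)).roots = (Finset.univ : Finset (Fin (m + 2))).val.map z := by rw [hzq, roots_prod_X_sub_C_fin]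
  have hcard : Multiset.card (q (m + 2)).roots = (q (m + 2)).natDegree := by
    rw [hroots, Multiset.card_map, Finset.card_val, Finset.card_univ, Fintype.card_fin, hmd.2]
  have hmem : z k ∈ (q (m + 2)).roots := by rw [hroots]; exact Multiset.mem_map_of_mem _ (Finset.mem_univ k)
  have h := Literature.Algebra.Polynomial.LaguerreRootBound.laguerre_sq_le hmd.1 hcard (by rw [hmd.2]; omega) hmem
  rw [hmd.2, show m + 2 - 1 = m + 1 by omega, show m + 2 - 2 = m by omega] at h
  -- the two coefficients in terms of the recurrence
  have hc1 : (q (m + 2)).coeff (m + 1) = -∑ i ∈ Finset.range (m + 2), a i := coeff_recurrence_sub_one hq0 hq1 hrec (m + 1)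
  have hS := coeff_recurrence_newton_two hq0 hq1 hrec m
  set c1 := (q (m + 2)).coeff (m + 1) with hc1def
  set c2 := (q (m + 2)).coeff m with hc2def
  set S := ∑ i ∈ Finset.range (m + 2), a i ^ 2 + 2 * ∑ i ∈ Finset.range (m + 1), b (i + 1) with hSdef
  have hc2 : c2 = (c1 ^ 2 - S) / 2 := by rw [← hS]; ring
  have hn : (0 : ℝ) < (m + 2 : ℕ) := by positivity
  have hn1 : (0 : ℝ) < ((m + 2 : ℕ) : ℝ) - 1 := by push_cast; linarith
  -- clear denominators in Laguerre's inequality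
  have key1 : (z k + c1 / ((m + 2 : ℕ) : ℝ)) ^ 2 * ((m + 2 : ℕ) : ℝ) ^ 2 = (((m : ℝ) + 2) * z k + c1) ^ 2 := by
    push_cast; field_simp
  have key2 : ((((m + 2 : ℕ) : ℝ) - 1) / ((m + 2 : ℕ) : ℝ)) ^ 2 * (c1 ^ 2 - 2 * ((m + 2 : ℕ) : ℝ) / (((m + 2 : ℕ) : ℝ) - 1) * c2) * ((m + 2 : ℕ) : ℝ) ^ 2 =
      ((m : ℝ) + 1) * (((m : ℝ) + 2) * S - c1 ^ 2) := by
    rw [hc2]; push_cast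
    have h1 : (m : ℝ) + 2 - 1 ≠ 0 := by linarith
    field_simp
    ring
  have h2 := mul_le_mul_of_nonneg_right h (sq_nonneg (((m + 2 : ℕ) : ℝ)))
  rw [key1, key2, hc1, neg_sq] at h2
  rw [sub_eq_add_neg]
  exact h2

/-- **… for a positive recurrence**: with `b > 0` the zeros `z_0 < ⋯ < z_{m+1}` of `q_{m+2}` (N279) all satisfy the Laguerre–Samuelson bound. [Laguerre 1880; Samuelson 1968; this file, §1077] -/
theorem recurrence_zeros_laguerre_samuelson_of_pos {q : ℕ → ℝ[X]} {a b : ℕ → ℝ} (hq0 : q 0 = 1) (hq1 : q 1 = Polynomial.X - C (a 0))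
    (hrec : ∀ n, q (n + 2) = (Polynomial.X - C (a (n + 1))) * q (n + 1) - C (b (n + 1)) * q n) (hb : ∀ j, 0 < b j) (m : ℕ) :
    ∃ z : Fin (m + 2) → ℝ, StrictMono z ∧ q (m + 2) = ∏ k, (Polynomial.X - C (z k)) ∧ ∀ k,
      (((m : ℝ) + 2) * z k - ∑ i ∈ Finset.range (m + 2), a i) ^ 2 ≤
        ((m : ℝ) + 1) * (((m : ℝ) + 2) * (∑ i ∈ Finset.range (m + 2), a i ^ 2 + 2 * ∑ i ∈ Finset.range (m + 1), b (i + 1)) - (∑ i ∈ Finset.range (m + 2), a i) ^ 2) := by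
  obtain ⟨z, hz, hzr, -⟩ := recurrence_zeros hq0 hq1 hrec hb (m + 1)
  have hmd := recurrence_monic_natDegree hq0 hq1 hrec (m + 2)
  have hzq : q (m + 2) = ∏ k, (Polynomial.X - C (z k)) := eq_prod_X_sub_C_of_monic_of_roots hmd.1 hmd.2 hz.injective hzr
  exact ⟨z, hz, hzq, fun k => recurrence_zeros_laguerre_samuelson hq0 hq1 hrec hzq k⟩

end Summit.Ventures.HSemireg.Wedge.HankelOuter
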